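import Literature.NumberTheory.EllipticCurves.PAdicHeightsLInvariantHoldsProofs
import Mathlib.NumberTheory.Padics.Complex
import HarnessLib

/-!
# Transport of `E₄(q)`, `Δ(q)`, `j(q)` along continuous field embeddings, and the Mahler–Manin
# theorem beyond `ℚ_p` (in `ℚ̄_p`, at the synthetic Tate parameters `q = p^k`)

Everything in this file is PROVED; there are no new definitions and no named facts.

**Sources.** J. H. Silverman, *Advanced Topics in the Arithmetic of Elliptic Curves*, GTM 151,
Thm. V.3.1 (b),(d) (PDF pp. 395–399): the `q`-expansions `E₄(q)`, `Δ(q) = q ∏ (1 − qⁿ)²⁴`,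
`j(E_q) = E₄(q)³/Δ(q) = 1/q + 744 + 196884 q + ⋯` converge for `|q| < 1` in a complete field and
"if `Σ αᵢ` is a convergent series with `αᵢ ∈ L`, then `(Σ αᵢ)^σ = Σ αᵢ^σ`" for a continuous field map
`σ` (p. 399) [cite: SilvermanATAEC1994, Thm. V.3.1 (b),(d) (PDF pp. 395–399)];
K. Barré-Sirieix, G. Diaz, F. Gramain, G. Philibert, *Une preuve de la conjecture de Mahler–Manin*,
Invent. Math. **124** (1996) 1–9, Théorème 1 (`p`-adic case: `q ∈ ℂ_p` algebraic, `0 < |q|_p < 1`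
⇒ `J(q)` transcendental) [cite: BarreSirieixDiazGramainPhilibert1996Manin, Théorème 1] — PROVED in
the tree for `q ∈ ℚ_p` as `Literature.NumberTheory.Transcendental.MahlerManinPadic_holds`
(`PAdicHeightsLInvariantHoldsProofs.lean`).

**Content.**
* `map_tateE4`, `map_tateDelta`, `map_tateJ` — a CONTINUOUS ring homomorphism `ι` out of a COMPLETE
  ultrametric normed field carries `E₄(q)`, `Δ(q)`, `j(q)` (`‖q‖ < 1`) to `E₄(ι q)`, `Δ(ι q)`, `j(ι q)`;
  the target need not be complete (the pattern of `TateCurve.map_tateA4` / `map_tateS`,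
  `UniformizationTransport.lean`; the `ℂ_p`-valued twin `tateJ_algebraMap_padicComplex` of
  `SteinWuthrich2013/NonsplitIntegralIsoProofs.lean` goes through the curve `E_q` and therefore needs a
  complete target — here the series are transported directly, `HasSum.map` / `HasProd.map`);
  `tateJ_algebraMap` — the `algebraMap` form for a normed algebra `A` (a field) over a complete `K`.
* `transcendental_tateJ_algebraMap` — Mahler–Manin transported: for `q ∈ ℚ_p` algebraic over `ℚ`,
  `0 < ‖q‖ < 1`, and ANY normed field `A` that is a normed `ℚ_p`-algebra (e.g. `A = ℚ̄_p = PadicAlgCl p`,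
  the carrier of the abc-iut cell's `ThetaSetting.qX`), `j(q)` read in `A` is transcendental over `ℚ`;
  `transcendental_tateJ_coe_padicAlgCl`; and at the SYNTHETIC Tate parameters `q = p^k` (`k ≠ 0`):
  `transcendental_tateJ_natCast_pow_padic`, `transcendental_tateJ_natCast_pow_padicAlgCl`
  (`Transcendental ℚ x` is by definition `¬ IsAlgebraic ℚ x`).

**Why (consumer, located not decided).** The tree's printed-strength typing of [AbsTopIII] Cor. 1.10
(iii) — the theorem Scholze–Stix 2018 §2.1.2 quote as their Theorem 7 («this functor is fully
faithful», ms. p. 5) — is `Literature.AnabelianGeometry.AbsoluteAnabelian.AbsTopIII.Cor_1_10_iii_natural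
D := IsAlgebraic ℚ (tateJ D.qX) → …` (`Cor110Natural.lean`, `D.qX : PadicAlgCl p`), the guard rendering
«`X` is of strictly Belyi type» as «`j(E_{q_X}) ∈ ℚ̄`».  At genuine data the guard holds (`j ∈ F`); at a
synthetic model with `q_X = p^k` it is FALSE by the corollaries below, so such an instance of the typed
fact holds vacuously and no synthetic model supplies the origin datum `hj` — a kernel decision that the
cell's census had recorded as «undecided in kernel» (abc-iut HOME/HANDOFF.md, K-L6 note 2026-08-26).
Nothing here concerns the disputed parts of the IUT corpus; no side is taken on [IUTchIII] Cor. 3.12;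
nothing here bears on the truth of abc.
-/

noncomputable section

namespace Literature.NumberTheory.EllipticCurves

open scoped ArithmeticFunction.sigma

/-! ### Continuous ring homomorphisms out of complete fields commute with `E₄`, `Δ`, `j` -/

section Map

variable {E F : Type*} [NormedField E] [IsUltrametricDist E] [CompleteSpace E] [NormedField F]
  (ι : E →+* F) (hι : Continuous ι)

include hι in
/-- `ι (E₄(q)) = E₄(ι q)` for a continuous ring homomorphism `ι` out of a complete ultrametric field and
`‖q‖ < 1`: the convergent series `Σ σ₃(n) qⁿ` is carried term by term (Silverman's "`(Σ αᵢ)^σ = Σ αᵢ^σ`").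
[cite: SilvermanATAEC1994, Thm. V.3.1 (b),(d) (PDF pp. 395–399)] -/
theorem map_tateE4 {q : E} (hq : ‖q‖ < 1) : ι (tateE4 q) = tateE4 (ι q) := by
  have hs := (summable_tateE4_term hq).hasSum.map ι hι
  have hfun : (ι ∘ fun n : ℕ ↦ ((σ 3 (n + 1) : ℕ) : E) * q ^ (n + 1)) =
      fun n : ℕ ↦ ((σ 3 (n + 1) : ℕ) : F) * ι q ^ (n + 1) := by
    funext n
    simp only [Function.comp_apply, map_mul, map_natCast, map_pow]
  rw [hfun] at hs
  rw [tateE4, tateE4, map_add, map_one, map_mul, map_ofNat, hs.tsum_eq]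

include hι in
/-- `ι (Δ(q)) = Δ(ι q)` for a continuous ring homomorphism `ι` out of a complete ultrametric field and
`‖q‖ < 1`: the convergent product `q ∏ (1 − qⁿ)²⁴` is carried factor by factor.
[cite: SilvermanATAEC1994, Thm. V.3.1 (b),(d) (PDF pp. 395–399)] -/
theorem map_tateDelta {q : E} (hq : ‖q‖ < 1) : ι (tateDelta q) = tateDelta (ι q) := by
  have hp := (multipliable_tateDelta_factor hq).hasProd.map ι hι
  have hfun : (ι ∘ fun n : ℕ ↦ (1 - q ^ (n + 1)) ^ 24) = fun n : ℕ ↦ (1 - ι q ^ (n + 1)) ^ 24 := by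
    funext n
    simp only [Function.comp_apply, map_pow, map_sub, map_one]
  rw [hfun] at hp
  rw [tateDelta, tateDelta, map_mul, hp.tprod_eq]

include hι in
/-- **`ι (j(q)) = j(ι q)`** for a continuous ring homomorphism `ι` out of a complete ultrametric field
and `‖q‖ < 1` (`j = E₄³/Δ`; the target field need not be complete).
[cite: SilvermanATAEC1994, Thm. V.3.1 (b),(d) (PDF pp. 395–399)] -/
theorem map_tateJ {q : E} (hq : ‖q‖ < 1) : ι (tateJ q) = tateJ (ι q) := by
  rw [tateJ, tateJ, map_div₀, map_pow, map_tateE4 ι hι hq, map_tateDelta ι hι hq]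

end Map

/-- **`j(q · 1_A) = j(q) · 1_A`**: `tateJ` commutes with the structure map of a normed algebra `A`
(a field) over a complete ultrametric field `K`, for `‖q‖ < 1`.
[cite: SilvermanATAEC1994, Thm. V.3.1 (b),(d) (PDF pp. 395–399)] -/
theorem tateJ_algebraMap {K : Type*} [NontriviallyNormedField K] [IsUltrametricDist K]
    [CompleteSpace K] (A : Type*) [NormedField A] [NormedAlgebra K A] {q : K} (hq : ‖q‖ < 1) :
    tateJ (algebraMap K A q) = algebraMap K A (tateJ q) :=
  (map_tateJ (algebraMap K A) (continuous_algebraMap K A) hq).symm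

/-! ### Mahler–Manin beyond `ℚ_p` -/

section MahlerManin

open Literature.NumberTheory.Transcendental

variable (p : ℕ) [Fact p.Prime]

/-- **Mahler–Manin, transported to any normed `ℚ_p`-algebra field** (Barré-Sirieix–Diaz–Gramain–
Philibert 1996, Théorème 1, via the tree's `MahlerManinPadic_holds`): for `q ∈ ℚ_p` algebraic over `ℚ`
with `0 < ‖q‖ < 1`, the element `j(q · 1_A) = j(q) · 1_A` of `A` is transcendental over `ℚ`.
[cite: BarreSirieixDiazGramainPhilibert1996Manin, Théorème 1] -/
theorem transcendental_tateJ_algebraMap (A : Type*) [NormedField A] [NormedAlgebra ℚ_[p] A]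
    [Algebra ℚ A] {q : ℚ_[p]} (hq0 : q ≠ 0) (hq1 : ‖q‖ < 1) (hq : IsAlgebraic ℚ q) :
    Transcendental ℚ (tateJ (algebraMap ℚ_[p] A q)) := by
  rw [tateJ_algebraMap A hq1]
  exact (MahlerManinPadic_holds p hq0 hq1 hq).ringHom_of_comp_eq (RingHom.id ℚ) (algebraMap ℚ_[p] A)
    Function.surjective_id (algebraMap ℚ_[p] A).injective (Subsingleton.elim _ _)

/-- **Mahler–Manin in `ℚ̄_p`** for parameters from `ℚ_p`: for `q ∈ ℚ_p` algebraic over `ℚ` with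
`0 < ‖q‖ < 1`, `j(q)` read in `ℚ̄_p = PadicAlgCl p` is transcendental over `ℚ`.
[cite: BarreSirieixDiazGramainPhilibert1996Manin, Théorème 1] -/
theorem transcendental_tateJ_coe_padicAlgCl {q : ℚ_[p]} (hq0 : q ≠ 0) (hq1 : ‖q‖ < 1)
    (hq : IsAlgebraic ℚ q) : Transcendental ℚ (tateJ (q : PadicAlgCl p)) :=
  transcendental_tateJ_algebraMap p (PadicAlgCl p) hq0 hq1 hq

/-- The synthetic Tate parameter `p^k ∈ ℚ_p` (`k ≠ 0`) has `p^k ≠ 0`, `‖p^k‖ < 1`, and is algebraic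
over `ℚ` (private helper). [folklore] -/
private theorem natCast_pow_padic_hyps {k : ℕ} (hk : k ≠ 0) :
    ((p : ℚ_[p]) ^ k ≠ 0) ∧ ‖(p : ℚ_[p]) ^ k‖ < 1 ∧ IsAlgebraic ℚ ((p : ℚ_[p]) ^ k) := by
  have hp : (p : ℚ_[p]) ≠ 0 := Nat.cast_ne_zero.mpr (Fact.out : p.Prime).ne_zero
  refine ⟨pow_ne_zero _ hp, ?_, ?_⟩
  · rw [norm_pow]
    exact pow_lt_one₀ (norm_nonneg _) Padic.norm_p_lt_one hk
  · simpa only [map_pow, map_natCast] using isAlgebraic_algebraMap (R := ℚ) (A := ℚ_[p]) ((p : ℚ) ^ k)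

/-- **`j(p^k)` is transcendental** (`k ≠ 0`), in `ℚ_p`: the Mahler–Manin theorem at the synthetic Tate
parameter `q = p^k`. [cite: BarreSirieixDiazGramainPhilibert1996Manin, Théorème 1] -/
theorem transcendental_tateJ_natCast_pow_padic {k : ℕ} (hk : k ≠ 0) :
    Transcendental ℚ (tateJ ((p : ℚ_[p]) ^ k)) := by
  obtain ⟨h0, h1, halg⟩ := natCast_pow_padic_hyps p hk
  exact MahlerManinPadic_holds p h0 h1 halg

/-- **`j(p^k)` is transcendental** (`k ≠ 0`), read in `ℚ̄_p = PadicAlgCl p` — i.e.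
`¬ IsAlgebraic ℚ (tateJ ((p : PadicAlgCl p) ^ k))`: the guard «`j(E_q) ∈ ℚ̄`» of a `ThetaSetting`-typed
statement is FALSE at a synthetic model with `q_X = p^k`.
[cite: BarreSirieixDiazGramainPhilibert1996Manin, Théorème 1] -/
theorem transcendental_tateJ_natCast_pow_padicAlgCl {k : ℕ} (hk : k ≠ 0) :
    Transcendental ℚ (tateJ ((p : PadicAlgCl p) ^ k)) := by
  obtain ⟨h0, h1, halg⟩ := natCast_pow_padic_hyps p hk
  have h := transcendental_tateJ_algebraMap p (PadicAlgCl p) h0 h1 halg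
  simpa only [map_pow, map_natCast] using h

/-- The same, spelled as the negation of the guard. [cite: BarreSirieixDiazGramainPhilibert1996Manin, Théorème 1] -/
theorem not_isAlgebraic_tateJ_natCast_pow_padicAlgCl {k : ℕ} (hk : k ≠ 0) :
    ¬ IsAlgebraic ℚ (tateJ ((p : PadicAlgCl p) ^ k)) :=
  transcendental_tateJ_natCast_pow_padicAlgCl p hk

end MahlerManin

end Literature.NumberTheory.EllipticCurves

end
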